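import Summits.ResolutionOfSingularities.ResolutionOfSingularities.Theorems.FrobeniusClosingPatchingRelPerfectDepthMultiHostCJSTransportStep
import HarnessLib

/-!
# Crux `PatchingRelPerfect` (stmt-ResolutionOfSingularities-16161), chain W5.2 — F7(β) (β-AX) T2b-X, module 1⁗:
# the JOINT PIECE STEP, predicate-parametric over the targets-v7 `StepStable` binder (RULING G12-1 / NOTE G12-2)

[OURS · L1 W5.2 · F7(β) (β-AX) T2b-X (res-L1-w52-plan-1 CORRECTION G11-15′ (2): hand res-D-pv-054 g7)] Fact-free; def-free;
NOT statements of the manuscript under review (Hironaka 2017); AI-written, weaker than expert review.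

Sibling of modules 1/1′/1″/1‴ (`…TransportStep` p548298, `…TransportPiece` p549615, `…TransportPieceP` p551160, `…TransportPieceR`
p556213): the SAME joint piece step THREADING A STEP-STABLE PREDICATE `P S cyl` whose stability hypothesis `hP` is VERBATIM the
targets-v7 `ChainW52F7BetaRP.StepStable P` (RULING G12-1 / NOTE G12-2: v6 + the CJS fields of the step in cylinder-state currency —
`D` = the reduced total host trace, `𝓘(D) ≤ C`, «singular or on a boundary trace» (`hBsing`, member-pinned), CJS permissibility of `C`
in `D` (`hperm`)); the piece΄s `hBsing`/`hperm` enter as HYPOTHESES (the loop and the transport derive them from the fact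
`IsBPermissibleSequenceB.blowup` through the carrier isomorphism and the earlier piece blow-ups); two new OUTPUTS feed the next pieces
and the equality invariant: `⋃ Supp tr′ = closure τZ⁻¹(D ∖ Z_p)` (tree `IsBlowup.support_controlledTransform_eq_closure`) and the
CONVERSE boundary link `∀ T′ ∈ 𝓑′, ∃ T ∈ S′.𝓔, T ≠ ker j′ ∧ bd′ T = T′` (from the lift΄s `bd′ T′ = T′|_{Z′}`: a member with
`bd′`-image in `𝓑′` is not `ker j′`, whose trace is `⊥`, as the members of `𝓑′` are effective Cartier).  The lift hypothesis `hlift`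
is res-D-pv-054΄s `CylState.lift_of_open_bd` universally closed: the lift the X2a-module-2 split (res-L1-w52-plan-1 RULING G11-21: M2a/M2c res-D-pv-034, M2b res-D-pv-054) actually
discharges — the lift is only required for a Noetherian ambient scheme, INTEGRAL Noetherian carriers and centres `C ≠ ⊥` (so that `V(C)` is nowhere dense in
the carrier and the generic-order laws `IsBlowup.strictTransformIdeal_eq_controlledTransform` apply on the carrier side); both
extra antecedents hold at every call (the carrier of the transport is integral Noetherian, a piece lies in a host trace).  As in
module 1 the hypothesis is res-D-pv-016΄s accepted signature of `CylState.lift` (scratch 3903f92e4eb0069b) universally closed with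
T2a (a) `hasSNCWith_centre` folded in as the first existential.

* `joint_piece_RP` — ONE PIECE `Z_p` of a CJS centre: the X-side blowing up `τ := Bl_{j(Z_p)} X` (`blowup.π`), generic orders
  `m i := ord_{Z_p} tr i`, weight `ν := 0` (always legal; `K′ = τ^* K` by `comap_K_eq_pow_mul_K_step`), the LIFT, and on the new
  carrier the E-side piece step of res-D-pv-054΄s `MultiHostCJS.piece_step` along the lift΄s `τZ` (hosts `τᶜ(tr i, m i)` = the new
  traces, boundary traces `𝓑.map st ++ [exc]` linked to the new members by the lift identities, snc, preirreducible supports, support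
  bounds and cover), `X′` regular, the centre regular (`HasSNCWith.isRegular_subscheme`) and on the carrier, AND `P S′ cyl′` from
  `P S cyl` by the step-stability hypothesis `hP` (applied to the lift΄s data).

## References
* V. Cossart, U. Jannsen, S. Saito, LNM 2270 (2020), Thm. 1.4, (6.2). [CossartJannsenSaito2020]
* J. Kollár, *Lectures on Resolution of Singularities* (2007), (3.111) Steps 1–3, Def. 3.25. [Kollar2007]
* E. Bierstone, D. Grigoriev, P. Milman, J. Włodarczyk (2011), Def. 3.1.3, §4 Step 2b. [BierstoneGrigorievMilmanWlodarczyk2011]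
* The Stacks Project, Tag 080A. [StacksProject]
-/

-- `Summit.<Summit>.<Sub>.Theorems` with `Sub = Summit` (single-conjunct summit, D-0017)
set_option linter.dupNamespace false

noncomputable section

open CategoryTheory CategoryTheory.Limits AlgebraicGeometry TopologicalSpace IsLocalRing
open Literature.AlgebraicGeometry.Resolution Scheme.IdealSheafData
open Literature.AlgebraicGeometry.Hironaka2017.MonomialPart

namespace Summit.ResolutionOfSingularities.ResolutionOfSingularities.Theorems

universe u

namespace MultiHostCJS

open DepthMultiHost WeightTwoB

/-! ## The JOINT PIECE STEP over the v7 step-stability binder -/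

section Joint

variable (hlift : ∀ ⦃X X' : Scheme.{u}⦄ [IsNoetherian X] [IsLocallyNoetherian X'] (S : MultiHostState X)
    (cyl : CylState S) [IsIntegral cyl.Z] [IsNoetherian cyl.Z] (C : cyl.Z.IdealSheafData), C ≠ ⊥ →
    Scheme.IsRegular C.subscheme → C = vanishingIdeal C.support →
    ∀ (𝓑 : List cyl.Z.IdealSheafData), (∀ T ∈ S.𝓔, T ≠ cyl.j.ker → cyl.bd T ∈ 𝓑) → HasSNCWith 𝓑 C →
    ∀ (τ : X' ⟶ X) (hτ : IsBlowup τ (vanishingIdeal (cyl.centre C))) (η : X), IsGenericPoint η (cyl.centre C : Set X) →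
    ∀ (m : Fin S.n → ℕ), (∀ i, cyl.tr i ≤ C ^ m i) → ∀ (ν : ℕ), (∀ i, ν ≤ m i + weightAt (S.exps i) η) →
    ∃ (hsncX : HasSNCWith S.𝓔 (vanishingIdeal (cyl.centre C)))
      (cyl' : CylState (S.step τ (cyl.centre C) η m ν hsncX hτ)) (τZ : cyl'.Z ⟶ cyl.Z),
      IsBlowup τZ C ∧ cyl'.j ≫ τ = τZ ≫ cyl.j ∧
      cyl'.j.ker = strictTransformIdeal τ (vanishingIdeal (cyl.centre C)) cyl.j.ker ∧
      (∀ i, cyl'.tr i = controlledTransform τZ C (cyl.tr i) (m i)) ∧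
      (∀ T ∈ S.𝓔, T ≠ cyl.j.ker →
        cyl'.bd (strictTransformIdeal τ (vanishingIdeal (cyl.centre C)) T) = strictTransformIdeal τZ C (cyl.bd T)) ∧
      cyl'.bd ((vanishingIdeal (cyl.centre C)).comap τ) = C.comap τZ ∧
      ((cyl'.V : Set X') ⊆ τ ⁻¹' (cyl.V : Set X)) ∧
      (τ ⁻¹' (cyl.V : Set X) \ (cyl'.V : Set X') ⊆
        ((controlledTransform τ (vanishingIdeal (cyl.centre C)) ((C.comap cyl.q).map cyl.V.ι) 1).support : Set X')) ∧
      (∀ T', cyl'.bd T' = T'.comap cyl'.j))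


variable (P : ∀ ⦃X : Scheme.{u}⦄ (S : MultiHostState X), CylState S → Prop)
  (hP : ∀ ⦃X X' : Scheme.{u}⦄ [IsLocallyNoetherian X] [IsLocallyNoetherian X'] (S : MultiHostState X)
    (cyl : CylState S) [IsIntegral cyl.Z] [IsNoetherian cyl.Z] (C : cyl.Z.IdealSheafData), C ≠ ⊥ →
    Scheme.IsRegular C.subscheme → C = vanishingIdeal C.support →
    ∀ (𝓑 : List cyl.Z.IdealSheafData), (∀ T ∈ S.𝓔, T ≠ cyl.j.ker → cyl.bd T ∈ 𝓑) → HasSNCWith 𝓑 C →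
    ∀ (D : Closeds cyl.Z), (D : Set cyl.Z) = ⋃ i, ((cyl.tr i).support : Set cyl.Z) →
    vanishingIdeal D ≤ C →
    (∀ x ∈ (C.support : Set cyl.Z),
      ¬ IsRegularLocalRing ((cyl.Z.presheaf.stalk x) ⧸ stalkIdeal (vanishingIdeal D) x) ∨
        ∃ T ∈ S.𝓔, T ≠ cyl.j.ker ∧ x ∈ ((cyl.bd T).support : Set cyl.Z)) →
    (∀ x ∈ (C.support : Set cyl.Z),
      ((stalkIdeal C x).map (Ideal.Quotient.mk (stalkIdeal (vanishingIdeal D) x))).IsPermissible) →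
    ∀ (τ : X' ⟶ X) (hτ : IsBlowup τ (vanishingIdeal (cyl.centre C))) (η : X), IsGenericPoint η (cyl.centre C : Set X) →
    ∀ (m : Fin S.n → ℕ), (∀ i, cyl.tr i ≤ C ^ m i) → (∀ i, ¬ cyl.tr i ≤ C ^ (m i + 1)) →
    ∀ (hsncX : HasSNCWith S.𝓔 (vanishingIdeal (cyl.centre C)))
      (cyl' : CylState (S.step τ (cyl.centre C) η m 0 hsncX hτ)) (τZ : cyl'.Z ⟶ cyl.Z),
      IsBlowup τZ C → cyl'.j ≫ τ = τZ ≫ cyl.j →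
      cyl'.j.ker = strictTransformIdeal τ (vanishingIdeal (cyl.centre C)) cyl.j.ker →
      (∀ i, cyl'.tr i = controlledTransform τZ C (cyl.tr i) (m i)) →
      (∀ T ∈ S.𝓔, T ≠ cyl.j.ker →
        cyl'.bd (strictTransformIdeal τ (vanishingIdeal (cyl.centre C)) T) = strictTransformIdeal τZ C (cyl.bd T)) →
      cyl'.bd ((vanishingIdeal (cyl.centre C)).comap τ) = C.comap τZ → ((cyl'.V : Set X') ⊆ τ ⁻¹' (cyl.V : Set X)) →
      (τ ⁻¹' (cyl.V : Set X) \ (cyl'.V : Set X') ⊆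
        ((controlledTransform τ (vanishingIdeal (cyl.centre C)) ((C.comap cyl.q).map cyl.V.ι) 1).support : Set X')) →
      P S cyl → P (S.step τ (cyl.centre C) η m 0 hsncX hτ) cyl')

include hlift hP

/-- [OURS · L1 W5.2 · F7(β) T2b-X] **THE JOINT PIECE STEP (integral-carrier lift hypothesis).** One piece `Z_p` of a CJS centre on the carrier of a cylinder state
(`X` Noetherian regular; the carrier integral Noetherian regular; boundary traces `𝓑` linked to the members, snc, preirreducible
supports; `Z_p` regular irreducible inside a host trace and snc with `𝓑`): blow `X` up along `j(Z_p)` (`blowup.π`) with the GENERIC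
ORDERS `m i = ord_{Z_p} tr i` and weight `0`, LIFT the cylinder state, and run the E-side piece step along the lift΄s carrier blowing
up `τZ`.  Outputs: the X-side blowing up (regular centre on the carrier, `X′` regular, `K′ = τ^*K`), the new cylinder state with
`τZ` (`IsBlowup τZ 𝓘(Z_p)`, `j′ ≫ τ = τZ ≫ j`), the new carrier integral Noetherian regular, the new cylinder region inside `τ⁻¹V` and losing only points of the weak transform of the cylinder over the piece, the new boundary traces
`𝓑.map st ++ [exc]` linked / snc / preirreducible, host bounds `τZ⁻¹(Supp tr i ∖ Z_p) ⊆ ⋃ Supp tr′`, `Supp tr′ i ⊆ τZ⁻¹ ⋃ Supp tr`,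
boundary bound and cover. [cite: Kollar2007, (3.111) Steps 1–3] [cite: CossartJannsenSaito2020, (6.2)]
[cite: BierstoneGrigorievMilmanWlodarczyk2011, Def. 3.1.3, §4 Step 2b] -/
theorem joint_piece_RP {X : Scheme.{u}} [IsNoetherian X] (hX : Scheme.IsRegular X) (S : MultiHostState X) (cyl : CylState S)
    (hPcyl : P S cyl)
    [IsIntegral cyl.Z] [IsNoetherian cyl.Z] (hZ : Scheme.IsRegular cyl.Z)
    (𝓑 : List cyl.Z.IdealSheafData) (hlink : ∀ T ∈ S.𝓔, T ≠ cyl.j.ker → cyl.bd T ∈ 𝓑) (hsnc𝓑 : HasSNC 𝓑)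
    (hirr𝓑 : ∀ T ∈ 𝓑, IsPreirreducible (T.support : Set cyl.Z))
    (Zp : Closeds cyl.Z) (hirr : IsIrreducible (Zp : Set cyl.Z)) (hZp : Scheme.IsRegular (vanishingIdeal Zp).subscheme)
    {i₀ : Fin S.n} (hZi₀ : (Zp : Set cyl.Z) ⊆ (cyl.tr i₀).support) (hsncZp : HasSNCWith 𝓑 (vanishingIdeal Zp))
    {B₀ : Set cyl.Z} (h𝓑B : ∀ T ∈ 𝓑, (T.support : Set cyl.Z) ⊆ B₀) (hZB : (Zp : Set cyl.Z) ⊆ B₀)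
    (hINV : ∀ T' ∈ 𝓑, ∃ T ∈ S.𝓔, T ≠ cyl.j.ker ∧ cyl.bd T = T')
    (D : Closeds cyl.Z) (hD : (D : Set cyl.Z) = ⋃ i, ((cyl.tr i).support : Set cyl.Z))
    (hBsZ : ∀ x ∈ (Zp : Set cyl.Z),
      ¬ IsRegularLocalRing ((cyl.Z.presheaf.stalk x) ⧸ stalkIdeal (vanishingIdeal D) x) ∨
        ∃ T ∈ S.𝓔, T ≠ cyl.j.ker ∧ x ∈ ((cyl.bd T).support : Set cyl.Z))
    (hpmZ : ∀ x ∈ (Zp : Set cyl.Z),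
      ((stalkIdeal (vanishingIdeal Zp) x).map (Ideal.Quotient.mk (stalkIdeal (vanishingIdeal D) x))).IsPermissible) :
    ∃ (X' : Scheme.{u}) (τ : X' ⟶ X) (_ : IsNoetherian X') (S' : MultiHostState X') (cyl' : CylState S')
      (τZ : cyl'.Z ⟶ cyl.Z) (_ : IsIntegral cyl'.Z) (_ : IsNoetherian cyl'.Z),
      P S' cyl' ∧ IsBlowup τ (vanishingIdeal (cyl.centre (vanishingIdeal Zp))) ∧
      Scheme.IsRegular (vanishingIdeal (cyl.centre (vanishingIdeal Zp))).subscheme ∧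
      ((cyl.centre (vanishingIdeal Zp) : Set X) ⊆ Set.range cyl.j) ∧
      Scheme.IsRegular X' ∧ S'.K = S.K.comap τ ∧ S'.n = S.n ∧
      IsBlowup τZ (vanishingIdeal Zp) ∧ cyl'.j ≫ τ = τZ ≫ cyl.j ∧ Scheme.IsRegular cyl'.Z ∧
      ((cyl'.V : Set X') ⊆ τ ⁻¹' (cyl.V : Set X)) ∧
      (τ ⁻¹' (cyl.V : Set X) \ (cyl'.V : Set X') ⊆
        ((controlledTransform τ (vanishingIdeal (cyl.centre (vanishingIdeal Zp))) (((vanishingIdeal Zp).comap cyl.q).map cyl.V.ι)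
          1).support : Set X')) ∧
      (∀ T ∈ S'.𝓔, T ≠ cyl'.j.ker →
        cyl'.bd T ∈ 𝓑.map (strictTransformIdeal τZ (vanishingIdeal Zp)) ++ [(vanishingIdeal Zp).comap τZ]) ∧
      HasSNC (𝓑.map (strictTransformIdeal τZ (vanishingIdeal Zp)) ++ [(vanishingIdeal Zp).comap τZ]) ∧
      (∀ T' ∈ 𝓑.map (strictTransformIdeal τZ (vanishingIdeal Zp)) ++ [(vanishingIdeal Zp).comap τZ],
        IsPreirreducible (T'.support : Set cyl'.Z)) ∧
      (∀ i, τZ ⁻¹' (((cyl.tr i).support : Set cyl.Z) \ (Zp : Set cyl.Z)) ⊆ ⋃ i', ((cyl'.tr i').support : Set cyl'.Z)) ∧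
      (∀ i', ((cyl'.tr i').support : Set cyl'.Z) ⊆ τZ ⁻¹' ⋃ i, ((cyl.tr i).support : Set cyl.Z)) ∧
      (∀ T' ∈ 𝓑.map (strictTransformIdeal τZ (vanishingIdeal Zp)) ++ [(vanishingIdeal Zp).comap τZ],
        (T'.support : Set cyl'.Z) ⊆ τZ ⁻¹' B₀) ∧
      (∀ x' : cyl'.Z, ((∃ T ∈ 𝓑, τZ x' ∈ T.support) ∨ τZ x' ∈ (Zp : Set cyl.Z)) →
        ∃ T' ∈ 𝓑.map (strictTransformIdeal τZ (vanishingIdeal Zp)) ++ [(vanishingIdeal Zp).comap τZ], x' ∈ T'.support) ∧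
      (⋃ i', ((cyl'.tr i').support : Set cyl'.Z)) = closure (τZ ⁻¹' ((D : Set cyl.Z) \ (Zp : Set cyl.Z))) ∧
      (∀ T' ∈ 𝓑.map (strictTransformIdeal τZ (vanishingIdeal Zp)) ++ [(vanishingIdeal Zp).comap τZ],
        ∃ T ∈ S'.𝓔, T ≠ cyl'.j.ker ∧ cyl'.bd T = T') := by
  haveI := cyl.closedImmersion
  set C : cyl.Z.IdealSheafData := vanishingIdeal Zp with hCdef
  set W : Closeds X := cyl.centre C with hWdef
  -- the X-side blowing up along `𝓘(W)`
  set τ : blowup (vanishingIdeal W) ⟶ X := blowup.π (vanishingIdeal W) with hτdef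
  have hτ : IsBlowup τ (vanishingIdeal W) := blowup.isBlowup _
  haveI : IsLocallyNoetherian (blowup (vanishingIdeal W)) := hτ.isLocallyNoetherian
  haveI : IsNoetherian (blowup (vanishingIdeal W)) := isNoetherian_of_isBlowup hτ
  -- generic points and orders
  obtain ⟨ηZ, hηZ⟩ : ∃ ηZ : cyl.Z, IsGenericPoint ηZ (Zp : Set cyl.Z) := QuasiSober.sober hirr Zp.isClosed
  have hCsupp : ((C.support : Closeds cyl.Z) : Set cyl.Z) = Zp := Scheme.IdealSheafData.coe_support_vanishingIdeal Zp
  have hηZ' : IsGenericPoint ηZ (C.support : Set cyl.Z) := by rwa [hCsupp]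
  have hη : IsGenericPoint (cyl.j ηZ) (W : Set X) := isGenericPoint_centre cyl C hηZ'
  have hord : ∀ i, ∃ m : ℕ, idealOrder (cyl.tr i) ηZ = m := fun i =>
    ENat.ne_top_iff_exists.mp (idealOrder_ne_top (HSepCJS.ne_bot_of_isEffectiveCartier (cyl.tr_isEffectiveCartier i)) ηZ)
      |>.imp fun _ h => h.symm
  choose m hm using hord
  have hmle : ∀ i, cyl.tr i ≤ C ^ m i := fun i => le_pow_of_idealOrder_genericPoint_eq hZ hZp hηZ' (hm i)
  have hC : C = vanishingIdeal C.support := vanishingIdeal_eq_vanishingIdeal_support Zp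
  -- THE LIFT (weight `0`)
  have hCne : C ≠ ⊥ := by
    intro h0
    have hZu : (Zp : Set cyl.Z) = Set.univ := by
      rw [← Scheme.IdealSheafData.coe_support_vanishingIdeal Zp, ← hCdef, h0, Scheme.IdealSheafData.support_bot]; rfl
    have hdense := (cyl.tr_isEffectiveCartier i₀).dense_compl_support
    have hempty : (((cyl.tr i₀).support : Set cyl.Z)ᶜ) = ∅ := by
      rw [Set.compl_empty_iff, Set.eq_univ_iff_forall]
      intro x
      exact hZi₀ (by rw [hZu]; trivial)
    have hne := hdense.nonempty
    rw [hempty] at hne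
    exact Set.not_nonempty_empty hne
  obtain ⟨hsncX, cyl', τZ, hτZ, hjτ, hker', htr', hbd', hbdexc, hV', hB, hbdj⟩ :=
    hlift S cyl C hCne hZp hC 𝓑 hlink hsncZp τ hτ (cyl.j ηZ) hη m hmle 0 (fun i => Nat.zero_le _)
  -- the CJS data of the piece, in the binder΄s currency
  have hDC : vanishingIdeal D ≤ C := by
    refine Scheme.IdealSheafData.le_support_iff_le_vanishingIdeal.mp ?_
    rw [← SetLike.coe_subset_coe, Scheme.IdealSheafData.coe_support_vanishingIdeal, hD]
    exact hZi₀.trans (Set.subset_iUnion (fun i => ((cyl.tr i).support : Set cyl.Z)) i₀)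
  have hBs : ∀ x ∈ (C.support : Set cyl.Z),
      ¬ IsRegularLocalRing ((cyl.Z.presheaf.stalk x) ⧸ stalkIdeal (vanishingIdeal D) x) ∨
        ∃ T ∈ S.𝓔, T ≠ cyl.j.ker ∧ x ∈ ((cyl.bd T).support : Set cyl.Z) := fun x hx => hBsZ x (by rwa [hCsupp] at hx)
  have hpm : ∀ x ∈ (C.support : Set cyl.Z),
      ((stalkIdeal C x).map (Ideal.Quotient.mk (stalkIdeal (vanishingIdeal D) x))).IsPermissible :=
    fun x hx => hpmZ x (by rwa [hCsupp] at hx)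
  have hmax : ∀ i, ¬ cyl.tr i ≤ C ^ (m i + 1) := fun i h => by
    have h2 := DepthTargets.le_idealOrder_of_le_pow h hηZ'.mem
    rw [hm i, Nat.cast_le] at h2
    omega
  have hP' : P _ cyl' := hP S cyl C hCne hZp hC 𝓑 hlink hsncZp D hD hDC hBs hpm τ hτ (cyl.j ηZ) hη m hmle hmax
    hsncX cyl' τZ hτZ hjτ hker' htr' hbd' hbdexc hV' hB hPcyl
  -- the E-side piece step along `τZ`
  obtain ⟨hint', hnoeth', hZ'reg, hcart', -, hsnc', hlow', hup', hbdB, hcov'⟩ :=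
    piece_step hZ cyl.tr_isEffectiveCartier hZp hZi₀ hsncZp m hmle h𝓑B hZB hτZ
  haveI := hint'
  haveI := hnoeth'
  refine ⟨blowup (vanishingIdeal W), τ, inferInstance, S.step τ W (cyl.j ηZ) m 0 hsncX hτ, cyl', τZ, hint', hnoeth', hP', hτ,
    hsncX.isRegular_subscheme, cyl.centre_subset_range C, hτ.isRegular_of_isRegular_subscheme hX hsncX.isRegular_subscheme, ?_,
    rfl, hτZ, hjτ, hZ'reg, hV', hB, ?_, hsnc', bd_isPreirreducible hZ hirr hZp (cyl.tr_isEffectiveCartier i₀) hZi₀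
      (fun T hT => hsnc𝓑.isEffectiveCartier_of_mem hT) hirr𝓑 hτZ, fun i => ?_, fun i' => ?_, hbdB, hcov', ?_, ?_⟩
  · -- `K′ = τ^* K` (weight `0`)
    have h := S.comap_K_eq_pow_mul_K_step τ W (cyl.j ηZ) m 0 hsncX hτ hη
      (fun i => host_le_pow_centre cyl C (hmle i)) (fun i => Nat.zero_le _)
    rw [pow_zero, Scheme.IdealSheafData.one_eq_top, Scheme.IdealSheafData.top_mul] at h
    exact h.symm
  · -- the new boundary traces are linked to the new members
    intro T' hT' hne'
    rw [MultiHostState.step_𝓔] at hT'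
    rcases List.mem_append.mp hT' with h | h
    · obtain ⟨T, hT, rfl⟩ := List.mem_map.mp h
      have hne : T ≠ cyl.j.ker := by
        rintro rfl
        exact hne' hker'.symm
      rw [hbd' T hT hne]
      exact List.mem_append_left _ (List.mem_map.mpr ⟨cyl.bd T, hlink T hT hne, rfl⟩)
    · rw [List.mem_singleton] at h
      subst h
      rw [hbdexc]
      exact List.mem_append_right _ (List.mem_singleton_self _)
  · -- lower bound for the host traces
    intro x' hx'
    exact Set.mem_iUnion.mpr ⟨i, by rw [htr' i]; exact hlow' i hx'⟩
  · -- upper bound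
    intro x' hx'
    rw [htr' i'] at hx'
    exact Set.mem_iUnion.mpr ⟨i', hup' i' hx'⟩
  · -- THE NEW TOTAL HOST TRACE IS THE STRICT TRANSFORM OF THE OLD ONE: `⋃ Supp tr′ = cl τZ⁻¹(D ∖ Z_p)` (Kollár 3.30.2)
    have hintZ : interior (C.support : Set cyl.Z) = ∅ :=
      interior_eq_empty_of_isGenericPoint_of_mem_support hηZ' (cyl.tr_isEffectiveCartier i₀) (hZi₀ hηZ.mem)
    have hi : ∀ i', ((cyl'.tr i').support : Set cyl'.Z) =
        closure (τZ ⁻¹' (((cyl.tr i').support : Set cyl.Z) \ (Zp : Set cyl.Z))) := fun i' => by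
      rw [htr' i', hτZ.support_controlledTransform_eq_closure hZ hZp hηZ' hintZ (hm i') (cyl.tr_isEffectiveCartier i'), hCsupp]
    rw [hD, Set.iUnion_sdiff, Set.preimage_iUnion, closure_iUnion_of_finite]
    exact Set.iUnion_congr hi
  · -- THE CONVERSE BOUNDARY LINK
    have hne_of_bd : ∀ T ∈ (S.step τ W (cyl.j ηZ) m 0 hsncX hτ).𝓔,
        cyl'.bd T ∈ 𝓑.map (strictTransformIdeal τZ C) ++ [C.comap τZ] → T ≠ cyl'.j.ker := by
      intro T _ hmem hTeq
      have hbot : cyl'.bd T = ⊥ := by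
        rw [hbdj, hTeq, ← le_bot_iff, (Scheme.IdealSheafData.map_gc cyl'.j).le_iff_le, Scheme.IdealSheafData.map_bot]
      rw [hbot] at hmem
      exact HSepCJS.ne_bot_of_isEffectiveCartier (hsnc'.isEffectiveCartier_of_mem hmem) rfl
    intro T' hT'
    rcases List.mem_append.mp hT' with h | h
    · obtain ⟨T₀, hT₀, rfl⟩ := List.mem_map.mp h
      obtain ⟨T, hT, hne, hbdT⟩ := hINV T₀ hT₀
      have hmemT : strictTransformIdeal τ (vanishingIdeal W) T ∈ (S.step τ W (cyl.j ηZ) m 0 hsncX hτ).𝓔 := by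
        rw [MultiHostState.step_𝓔]
        exact List.mem_append_left _ (List.mem_map.mpr ⟨T, hT, rfl⟩)
      have hbd₁ : cyl'.bd (strictTransformIdeal τ (vanishingIdeal W) T) = strictTransformIdeal τZ C T₀ := by
        rw [hbd' T hT hne, hbdT]
      exact ⟨_, hmemT, hne_of_bd _ hmemT (hbd₁ ▸ hT'), hbd₁⟩
    · rw [List.mem_singleton] at h
      subst h
      have hmemE : (vanishingIdeal W).comap τ ∈ (S.step τ W (cyl.j ηZ) m 0 hsncX hτ).𝓔 := by
        rw [MultiHostState.step_𝓔]
        exact List.mem_append_right _ (List.mem_singleton_self _)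
      exact ⟨_, hmemE, hne_of_bd _ hmemE (hbdexc ▸ hT'), hbdexc⟩

end Joint

end MultiHostCJS

end Summit.ResolutionOfSingularities.ResolutionOfSingularities.Theorems

end
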